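import Mathlib
import Literature.NumberTheory.LFunctions.PolynomialRootMoebiusRieszMean
import Literature.NumberTheory.LFunctions.IdealMoebius
import Literature.NumberTheory.LFunctions.IdealCountProofs
import HarnessLib

/-!
# Short-interval mass of `|μ(n)ρ_g(n)|` via ideal counting

Topic `Literature/NumberTheory/LFunctions` (sequel to `PolynomialRootMoebiusDirichlet.lean`,
`PolynomialRootMoebiusRieszMean.lean`, `IdealMoebius.lean`, `IdealCountProofs.lean`). Everything here is
PROVED; no definitions, no named facts.

For `g ∈ ℤ[X]` irreducible of positive degree, `ρ_g(n) = #{r mod n : g(r) ≡ 0 (mod n)}`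
(`Literature.NumberTheory.Sieve.polyRootCountMod ![g] n`), `a = μρ_g`, `K = ℚ[X]/(g)`, `c_K` the ideal
counting function, `m_K` the Möbius function summed over ideals of given norm, `h = a ⋆ c_K`:

* `MoebiusRootCount.abs_moebius_mul_rootCount_le` — `|a| ≤ |h| ⋆ c_K` (from `a = h ⋆ m_K`,
  `c_K ⋆ m_K = δ`, `|m_K| ≤ c_K`);
* `MoebiusRootCount.idealCount_shortInterval_le` — short differences of the Weber–Landau ideal count,
  `I_K(⌊y⌋/d) − I_K(⌊x⌋/d) ≤ ρ_K (y−x)/d + C₂ (y/d)^θ` (`θ < 1`);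
* `MoebiusRootCount.shortInterval_abs_moebius_mul_rootCount_le` — **the short-interval mass**
  `∑_{x < n ≤ y} |μ(n)|ρ_g(n) ≤ A₁(y − x) + A₂ y^θ` for `1 ≤ x ≤ y`, some `θ < 1`
  (`∑ |h(n)| n^{-3/4} < ∞` by Dedekind–Kummer, tree `lseriesSummable_rootExcess`).

This is the input that turns the log-Riesz form of Landau's theorem for `∑ μ(n)ρ_g(n)/n` into the
sharp-cutoff form (`PolynomialRootMoebiusSharpCutoff.lean`).

## References

* E. Landau, *Neuer Beweis des Primzahlsatzes und Beweis des Primidealsatzes*, Math. Ann. 56 (1903),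
  645–670, Part II (ideal counting and the prime ideal theorem). [LandauMathAnn1903]
* H. L. Montgomery, R. C. Vaughan, *Multiplicative Number Theory I*, CUP 2007, §8.4 (Weber's theorem on
  the number of ideals of norm `≤ x`, Landau's prime ideal theorem). [MontgomeryVaughan2007]

## Mathlib / tree search

Mathlib: `ArithmeticFunction.sum_Ioc_mul_eq_sum_sum`, `Finset.sum_Ioc_consecutive`,
`Nat.floor_div_natCast`, `LSeries.norm_term_eq`. Tree: `lseriesSummable_rootExcess`,
`exists_rootExcess_prime_eq_zero`, `moebiusRootCount_apply` (`PolynomialRootMoebiusRieszMean.lean` /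
`PolynomialRootMoebiusDirichlet.lean`); `NumberField.convolution_idealMoebiusNormSum_idealNormCount`,
`NumberField.abs_idealMoebiusNormSum_le` (`IdealMoebius.lean`); `NumberField.idealCount_sub_residue_mul_le_holds`,
`NumberField.idealCount_natCast_eq_sum`, `NumberField.idealCount_eq_idealCount_floor` (`IdealCountProofs.lean`).
No short-interval bound for `ρ_g` or for divisor-bounded multiplicative functions existed
(`lean search 'shortInterval|Shiu'`).
-/

noncomputable section

open Filter Finset Nat ArithmeticFunction Polynomial Complex
open scoped Topology BigOperators NumberField ArithmeticFunction.Moebius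

namespace Literature.NumberTheory.LFunctions

open Literature.NumberTheory.Sieve

namespace MoebiusRootCount

variable (K : Type*) [Field K] [NumberField K]

/-! ### `|μρ_g| ≤ |h| ⋆ c_K` -/

/-- `c_K ⋆ m_K = 1` as complex arithmetic functions. [folklore] -/
theorem idealCount_mul_idealMoebius_eq_one : ((toArithmeticFunction (fun n : ℕ => ((idealNormCount K n : ℕ) : ℂ)))) * ((toArithmeticFunction (fun n : ℕ => ((NumberField.idealMoebiusNormSum K n : ℤ) : ℂ)))) = 1 := by
  have h := NumberField.convolution_idealMoebiusNormSum_idealNormCount K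
  rw [LSeries.convolution] at h
  rw [mul_comm]
  apply ArithmeticFunction.coe_inj.mp
  rw [h]
  exact ArithmeticFunction.one_eq_delta.symm

/-- `a = h ⋆ m_K` (`a ⋆ c_K = h`, `c_K ⋆ m_K = 1`). [folklore] -/
theorem moebiusRootCount_eq_rootExcess_mul (g : ℤ[X]) : (toArithmeticFunction (fun n : ℕ => ((ArithmeticFunction.moebius n : ℤ) : ℂ) * ((polyRootCountMod ![g] n : ℕ) : ℂ))) = ((toArithmeticFunction (fun n : ℕ => ((ArithmeticFunction.moebius n : ℤ) : ℂ) * ((polyRootCountMod ![g] n : ℕ) : ℂ))) *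
      (toArithmeticFunction (fun n : ℕ => ((idealNormCount K n : ℕ) : ℂ))) : ArithmeticFunction ℂ) * (toArithmeticFunction (fun n : ℕ => ((NumberField.idealMoebiusNormSum K n : ℤ) : ℂ))) := by
  rw [mul_assoc, idealCount_mul_idealMoebius_eq_one, mul_one]

/-- `|μ(n)ρ_g(n)| ≤ ∑_{de = n} ‖h(d)‖ c_K(e)`. [folklore] -/
theorem abs_moebius_mul_rootCount_le (g : ℤ[X]) (n : ℕ) :
    |(ArithmeticFunction.moebius n : ℝ) * (polyRootCountMod ![g] n : ℝ)| ≤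
      ∑ p ∈ n.divisorsAntidiagonal, ‖((toArithmeticFunction (fun n : ℕ => ((ArithmeticFunction.moebius n : ℤ) : ℂ) * ((polyRootCountMod ![g] n : ℕ) : ℂ))) *
      (toArithmeticFunction (fun n : ℕ => ((idealNormCount K n : ℕ) : ℂ))) : ArithmeticFunction ℂ) p.1‖ * (idealNormCount K p.2 : ℝ) := by
  have h1 : ‖(toArithmeticFunction (fun n : ℕ => ((ArithmeticFunction.moebius n : ℤ) : ℂ) * ((polyRootCountMod ![g] n : ℕ) : ℂ))) n‖ = |(ArithmeticFunction.moebius n : ℝ) * (polyRootCountMod ![g] n : ℝ)| := by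
    have : (toArithmeticFunction (fun n : ℕ => ((ArithmeticFunction.moebius n : ℤ) : ℂ) * ((polyRootCountMod ![g] n : ℕ) : ℂ))) n = (((ArithmeticFunction.moebius n : ℝ) * (polyRootCountMod ![g] n : ℝ) : ℝ) : ℂ) := by
      rw [moebiusRootCount_apply]; push_cast; ring
    rw [this, Complex.norm_real, Real.norm_eq_abs]
  have e := congrArg (fun F : ArithmeticFunction ℂ => F n) (moebiusRootCount_eq_rootExcess_mul K g)
  beta_reduce at e
  rw [← h1, e, ArithmeticFunction.mul_apply]
  refine (norm_sum_le _ _).trans (Finset.sum_le_sum fun p hp => ?_)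
  rw [norm_mul]
  gcongr
  have hp2 : p.2 ≠ 0 := (Nat.ne_zero_of_mem_divisorsAntidiagonal hp).2
  simp only [toArithmeticFunction, ArithmeticFunction.coe_mk, if_neg hp2, Complex.norm_intCast]
  exact NumberField.abs_idealMoebiusNormSum_le K p.2

/-! ### Short-interval mass of `|μρ_g|` via ideal counting -/

/-- Rearrangement: `∑_{X < n ≤ Y} |μ(n)ρ_g(n)| ≤ ∑_{d ≤ Y} ‖h(d)‖ (I_K(Y/d) − I_K(X/d))`. [folklore] -/
theorem sum_Ioc_abs_moebius_mul_rootCount_le (g : ℤ[X]) {X Y : ℕ} (hXY : X ≤ Y) :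
    ∑ n ∈ Ioc X Y, |(ArithmeticFunction.moebius n : ℝ) * (polyRootCountMod ![g] n : ℝ)| ≤
      ∑ d ∈ Ioc 0 Y, ‖((toArithmeticFunction (fun n : ℕ => ((ArithmeticFunction.moebius n : ℤ) : ℂ) * ((polyRootCountMod ![g] n : ℕ) : ℂ))) *
      (toArithmeticFunction (fun n : ℕ => ((idealNormCount K n : ℕ) : ℂ))) : ArithmeticFunction ℂ) d‖ *
        ((NumberField.idealCount K ((Y / d : ℕ) : ℝ) : ℝ) -
          (NumberField.idealCount K ((X / d : ℕ) : ℝ) : ℝ)) := by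
  classical
  set F : ArithmeticFunction ℝ := ⟨fun n => ‖((toArithmeticFunction (fun n : ℕ => ((ArithmeticFunction.moebius n : ℤ) : ℂ) * ((polyRootCountMod ![g] n : ℕ) : ℂ))) *
      (toArithmeticFunction (fun n : ℕ => ((idealNormCount K n : ℕ) : ℂ))) : ArithmeticFunction ℂ) n‖, by simp⟩ with hF
  set G : ArithmeticFunction ℝ := toArithmeticFunction (fun n : ℕ => (idealNormCount K n : ℝ)) with hG
  have hFapply : ∀ n, F n = ‖((toArithmeticFunction (fun n : ℕ => ((ArithmeticFunction.moebius n : ℤ) : ℂ) * ((polyRootCountMod ![g] n : ℕ) : ℂ))) *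
      (toArithmeticFunction (fun n : ℕ => ((idealNormCount K n : ℕ) : ℂ))) : ArithmeticFunction ℂ) n‖ := fun n => rfl
  have hGapply : ∀ {n : ℕ}, n ≠ 0 → G n = (idealNormCount K n : ℝ) := fun {n} hn => by
    simp [hG, toArithmeticFunction, hn]
  -- `∑_{m ≤ M} G m = I_K(M)`
  have hGsum : ∀ M : ℕ, ∑ m ∈ Ioc 0 M, G m = (NumberField.idealCount K (M : ℝ) : ℝ) := by
    intro M
    rw [NumberField.idealCount_natCast_eq_sum, Nat.cast_sum, ← Finset.Icc_add_one_left_eq_Ioc,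
      zero_add]
    refine Finset.sum_congr rfl fun m hm => ?_
    rw [hGapply (by simp only [Finset.mem_Icc] at hm; omega), idealNormCount_def]
  -- termwise comparison with `F * G`
  have h1 : ∑ n ∈ Ioc X Y, |(ArithmeticFunction.moebius n : ℝ) * (polyRootCountMod ![g] n : ℝ)| ≤
      ∑ n ∈ Ioc X Y, (F * G) n := by
    refine Finset.sum_le_sum fun n _ => ?_
    rw [ArithmeticFunction.mul_apply]
    refine (abs_moebius_mul_rootCount_le K g n).trans (le_of_eq ?_)
    refine Finset.sum_congr rfl fun p hp => ?_
    rw [hFapply, hGapply (Nat.ne_zero_of_mem_divisorsAntidiagonal hp).2]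
  -- the full sums
  have h2 : ∀ N : ℕ, ∑ n ∈ Ioc 0 N, (F * G) n =
      ∑ d ∈ Ioc 0 N, F d * (NumberField.idealCount K ((N / d : ℕ) : ℝ) : ℝ) := by
    intro N
    rw [ArithmeticFunction.sum_Ioc_mul_eq_sum_sum]
    refine Finset.sum_congr rfl fun d _ => ?_
    rw [hGsum]
  have h3 : ∑ n ∈ Ioc X Y, (F * G) n =
      ∑ n ∈ Ioc 0 Y, (F * G) n - ∑ n ∈ Ioc 0 X, (F * G) n := by
    rw [← Finset.sum_Ioc_consecutive _ (Nat.zero_le X) hXY]; ring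
  -- extend the second sum to `d ≤ Y` (the extra terms vanish: `X/d = 0`, `I_K(0) = 0`)
  have hI0 : (NumberField.idealCount K ((0 : ℕ) : ℝ) : ℝ) = 0 := by
    rw [NumberField.idealCount_natCast_eq_sum]; simp
  have h4 : ∑ d ∈ Ioc 0 X, F d * (NumberField.idealCount K ((X / d : ℕ) : ℝ) : ℝ) =
      ∑ d ∈ Ioc 0 Y, F d * (NumberField.idealCount K ((X / d : ℕ) : ℝ) : ℝ) := by
    rw [← Finset.sum_Ioc_consecutive _ (Nat.zero_le X) hXY, eq_comm, add_eq_left]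
    refine Finset.sum_eq_zero fun d hd => ?_
    rw [Finset.mem_Ioc] at hd
    rw [Nat.div_eq_of_lt hd.1, hI0, mul_zero]
  calc ∑ n ∈ Ioc X Y, |(ArithmeticFunction.moebius n : ℝ) * (polyRootCountMod ![g] n : ℝ)|
      ≤ ∑ n ∈ Ioc X Y, (F * G) n := h1
    _ = ∑ d ∈ Ioc 0 Y, F d * (NumberField.idealCount K ((Y / d : ℕ) : ℝ) : ℝ) -
          ∑ d ∈ Ioc 0 Y, F d * (NumberField.idealCount K ((X / d : ℕ) : ℝ) : ℝ) := by
        rw [h3, h2, h2, h4]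
    _ = _ := by
        rw [← Finset.sum_sub_distrib]
        refine Finset.sum_congr rfl fun d _ => ?_
        rw [hFapply, mul_sub]

/-- Short differences of the ideal count: `I_K(⌊y⌋/d) − I_K(⌊x⌋/d) ≤ ρ_K (y−x)/d + C₂ (y/d)^θ` for
`1 ≤ x ≤ y`, `1 ≤ d ≤ y`, with some `C₂ ≥ 0` and `θ ∈ [3/4, 1)` (Weber–Landau). [folklore] -/
theorem idealCount_shortInterval_le :
    ∃ C₂ θ : ℝ, 0 ≤ C₂ ∧ 3 / 4 ≤ θ ∧ θ < 1 ∧ ∀ x y : ℝ, 1 ≤ x → x ≤ y → ∀ d : ℕ, 1 ≤ d → (d : ℝ) ≤ y →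
      (NumberField.idealCount K ((⌊y⌋₊ / d : ℕ) : ℝ) : ℝ) -
          (NumberField.idealCount K ((⌊x⌋₊ / d : ℕ) : ℝ) : ℝ) ≤
        _root_.NumberField.dedekindZeta_residue K * ((y - x) / d) + C₂ * (y / d) ^ θ := by
  obtain ⟨C, hC⟩ := NumberField.idealCount_sub_residue_mul_le_holds K
  set ρ : ℝ := _root_.NumberField.dedekindZeta_residue K with hρ
  have hρpos : 0 < ρ := _root_.NumberField.dedekindZeta_residue_pos K
  set θ₀ : ℝ := 1 - 1 / (Module.finrank ℚ K : ℝ) with hθ₀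
  set θ : ℝ := max θ₀ (3 / 4) with hθ
  set C' : ℝ := max C 0 with hC'
  have hθ₀1 : θ₀ < 1 := by
    have : (0 : ℝ) < Module.finrank ℚ K := by exact_mod_cast Module.finrank_pos
    rw [hθ₀]
    have : 0 < 1 / (Module.finrank ℚ K : ℝ) := by positivity
    linarith
  have hθ1 : θ < 1 := max_lt hθ₀1 (by norm_num)
  have hθ34 : 3 / 4 ≤ θ := le_max_right _ _
  have hθ0 : 0 ≤ θ := le_trans (by norm_num) hθ34
  -- the count with exponent `θ` and constant `C' ≥ 0`
  have hI : ∀ t : ℝ, 1 ≤ t → |(NumberField.idealCount K t : ℝ) - ρ * t| ≤ C' * t ^ θ := by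
    intro t ht
    refine (hC t ht).trans ?_
    calc C * t ^ (1 - 1 / (Module.finrank ℚ K : ℝ)) ≤ C' * t ^ θ₀ :=
          mul_le_mul_of_nonneg_right (le_max_left _ _) (by positivity)
      _ ≤ C' * t ^ θ := by
          refine mul_le_mul_of_nonneg_left ?_ (le_max_right _ _)
          exact Real.rpow_le_rpow_of_exponent_le ht (le_max_left _ _)
  -- `I_K(⌊t⌋₊ / d) = I_K(t/d)`
  have hfl : ∀ t : ℝ, 0 ≤ t → ∀ d : ℕ,
      NumberField.idealCount K ((⌊t⌋₊ / d : ℕ) : ℝ) = NumberField.idealCount K (t / d) := by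
    intro t ht d
    rw [NumberField.idealCount_eq_idealCount_floor K (by positivity : 0 ≤ t / d),
      Nat.floor_div_natCast]
  refine ⟨ρ + 2 * C', θ, by positivity, hθ34, hθ1, fun x y hx hxy d hd hdy => ?_⟩
  have hd0 : (0 : ℝ) < d := by exact_mod_cast hd
  have hy0 : 0 ≤ y := by linarith
  have hyd : 1 ≤ y / d := by rwa [le_div_iff₀ hd0, one_mul]
  have hyθ : 1 ≤ (y / d) ^ θ := Real.one_le_rpow hyd hθ0
  rw [hfl y hy0, hfl x (by linarith)]
  have hIy := (abs_le.mp (hI (y / d) hyd)).2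
  rcases le_or_gt 1 (x / d) with hxd | hxd
  · have hIx := (abs_le.mp (hI (x / d) hxd)).1
    have hmono : (x / d) ^ θ ≤ (y / d) ^ θ :=
      Real.rpow_le_rpow (by positivity) (div_le_div_of_nonneg_right hxy hd0.le) hθ0
    have hC'0 : 0 ≤ C' := le_max_right _ _
    have : ρ * (y / d) - ρ * (x / d) = ρ * ((y - x) / d) := by ring
    nlinarith
  · have hIx : (0 : ℝ) ≤ NumberField.idealCount K (x / d) := Nat.cast_nonneg _
    have hC'0 : 0 ≤ C' := le_max_right _ _
    have h1 : ρ * (x / d) ≤ ρ * (y / d) ^ θ := by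
      refine mul_le_mul_of_nonneg_left (hxd.le.trans hyθ) hρpos.le
    have : ρ * (y / d) = ρ * ((y - x) / d) + ρ * (x / d) := by ring
    nlinarith

/-- Partial sums `∑_{d ≤ Y} ‖f(d)‖ d^{-t}` (`t ≥ 3/4`) are bounded by `∑' ‖f(n)‖ n^{-3/4}`. [folklore] -/
theorem sum_norm_div_rpow_le_of_tsum_le {f : ℕ → ℂ} {B : ℝ}
    (hs : Summable fun n => ‖LSeries.term f ((3 / 4 : ℝ) : ℂ) n‖)
    (hB : ∑' n, ‖LSeries.term f ((3 / 4 : ℝ) : ℂ) n‖ ≤ B) (Y : ℕ) {t : ℝ} (ht : 3 / 4 ≤ t) :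
    ∑ d ∈ Ioc 0 Y, ‖f d‖ / (d : ℝ) ^ t ≤ B := by
  refine le_trans ?_ ((Summable.sum_le_tsum (Ioc 0 Y) (fun n _ => norm_nonneg _) hs).trans hB)
  refine Finset.sum_le_sum fun d hd => ?_
  rw [Finset.mem_Ioc] at hd
  have hd1 : (1 : ℝ) ≤ d := by exact_mod_cast hd.1
  rw [LSeries.norm_term_eq, if_neg (by omega), Complex.ofReal_re]
  refine div_le_div_of_nonneg_left (norm_nonneg _) (by positivity) ?_
  exact Real.rpow_le_rpow_of_exponent_le hd1 ht

/-- **Short-interval mass of `|μρ_g|`**: for `g` irreducible of positive degree there are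
`A₁, A₂ ≥ 0` and `θ < 1` with `∑_{x < n ≤ y} |μ(n)|ρ_g(n) ≤ A₁(y − x) + A₂ y^θ` for `1 ≤ x ≤ y`
(from `|μρ_g| ≤ |h| ⋆ c_K` and the Weber–Landau ideal count). [folklore] -/
theorem shortInterval_abs_moebius_mul_rootCount_le {g : ℤ[X]} (hirr : Irreducible g)
    (hdeg : 0 < g.natDegree) :
    ∃ A₁ A₂ θ : ℝ, 0 ≤ A₁ ∧ 0 ≤ A₂ ∧ θ < 1 ∧ ∀ x y : ℝ, 1 ≤ x → x ≤ y →
      ∑ n ∈ Ioc ⌊x⌋₊ ⌊y⌋₊, |(ArithmeticFunction.moebius n : ℝ) * (polyRootCountMod ![g] n : ℝ)| ≤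
        A₁ * (y - x) + A₂ * y ^ θ := by
  haveI : Fact (Irreducible ((integralNormalization g).map (algebraMap ℤ ℚ))) :=
    ⟨DegreeOnePrimes.irreducible_map_rat (monic_integralNormalization hirr.ne_zero)
      (irreducible_integralNormalization hirr hdeg)⟩
  obtain ⟨B, hhs, hhB⟩ := lseriesSummable_rootExcess
    (AdjoinRoot ((integralNormalization g).map (algebraMap ℤ ℚ))) hirr hdeg
    (exists_rootExcess_prime_eq_zero hirr hdeg)
  obtain ⟨C₂, θ, hC₂, hθ34, hθ1, hI⟩ :=
    idealCount_shortInterval_le (AdjoinRoot ((integralNormalization g).map (algebraMap ℤ ℚ)))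
  set K := AdjoinRoot ((integralNormalization g).map (algebraMap ℤ ℚ)) with hK
  set ρ : ℝ := _root_.NumberField.dedekindZeta_residue K with hρ
  have hρpos : 0 < ρ := _root_.NumberField.dedekindZeta_residue_pos K
  have hsum : Summable fun n => ‖LSeries.term (((toArithmeticFunction (fun n : ℕ => ((ArithmeticFunction.moebius n : ℤ) : ℂ) * ((polyRootCountMod ![g] n : ℕ) : ℂ))) *
      (toArithmeticFunction (fun n : ℕ => ((idealNormCount K n : ℕ) : ℂ))) : ArithmeticFunction ℂ)) ((3 / 4 : ℝ) : ℂ) n‖ := hhs.norm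
  have hB0 : 0 ≤ B := (tsum_nonneg fun n => norm_nonneg _).trans hhB
  refine ⟨ρ * B, C₂ * B, θ, by positivity, by positivity, hθ1, fun x y hx hxy => ?_⟩
  have hy0 : 0 ≤ y := by linarith
  have hXY : ⌊x⌋₊ ≤ ⌊y⌋₊ := Nat.floor_le_floor hxy
  refine (sum_Ioc_abs_moebius_mul_rootCount_le K g hXY).trans ?_
  have hmem : ∀ d ∈ Ioc 0 ⌊y⌋₊, 1 ≤ d ∧ (d : ℝ) ≤ y := by
    intro d hd
    rw [Finset.mem_Ioc] at hd
    exact ⟨hd.1, (Nat.cast_le.mpr hd.2).trans (Nat.floor_le hy0)⟩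
  calc ∑ d ∈ Ioc 0 ⌊y⌋₊, ‖((toArithmeticFunction (fun n : ℕ => ((ArithmeticFunction.moebius n : ℤ) : ℂ) * ((polyRootCountMod ![g] n : ℕ) : ℂ))) *
      (toArithmeticFunction (fun n : ℕ => ((idealNormCount K n : ℕ) : ℂ))) : ArithmeticFunction ℂ) d‖ *
        ((NumberField.idealCount K ((⌊y⌋₊ / d : ℕ) : ℝ) : ℝ) -
          (NumberField.idealCount K ((⌊x⌋₊ / d : ℕ) : ℝ) : ℝ))
      ≤ ∑ d ∈ Ioc 0 ⌊y⌋₊, ‖((toArithmeticFunction (fun n : ℕ => ((ArithmeticFunction.moebius n : ℤ) : ℂ) * ((polyRootCountMod ![g] n : ℕ) : ℂ))) *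
      (toArithmeticFunction (fun n : ℕ => ((idealNormCount K n : ℕ) : ℂ))) : ArithmeticFunction ℂ) d‖ * (ρ * ((y - x) / d) + C₂ * (y / d) ^ θ) :=
        Finset.sum_le_sum fun d hd =>
          mul_le_mul_of_nonneg_left (hI x y hx hxy d (hmem d hd).1 (hmem d hd).2) (norm_nonneg _)
    _ = ρ * (y - x) * ∑ d ∈ Ioc 0 ⌊y⌋₊, ‖((toArithmeticFunction (fun n : ℕ => ((ArithmeticFunction.moebius n : ℤ) : ℂ) * ((polyRootCountMod ![g] n : ℕ) : ℂ))) *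
      (toArithmeticFunction (fun n : ℕ => ((idealNormCount K n : ℕ) : ℂ))) : ArithmeticFunction ℂ) d‖ / (d : ℝ) ^ (1 : ℝ) +
          C₂ * y ^ θ * ∑ d ∈ Ioc 0 ⌊y⌋₊, ‖((toArithmeticFunction (fun n : ℕ => ((ArithmeticFunction.moebius n : ℤ) : ℂ) * ((polyRootCountMod ![g] n : ℕ) : ℂ))) *
      (toArithmeticFunction (fun n : ℕ => ((idealNormCount K n : ℕ) : ℂ))) : ArithmeticFunction ℂ) d‖ / (d : ℝ) ^ θ := by
        rw [Finset.mul_sum, Finset.mul_sum, ← Finset.sum_add_distrib]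
        refine Finset.sum_congr rfl fun d hd => ?_
        have hd0 : (0 : ℝ) ≤ d := Nat.cast_nonneg _
        rw [Real.rpow_one, Real.div_rpow hy0 hd0]
        ring
    _ ≤ ρ * (y - x) * B + C₂ * y ^ θ * B := by
        exact add_le_add
          (mul_le_mul_of_nonneg_left (sum_norm_div_rpow_le_of_tsum_le hsum hhB _ (by norm_num))
            (mul_nonneg hρpos.le (by linarith)))
          (mul_le_mul_of_nonneg_left (sum_norm_div_rpow_le_of_tsum_le hsum hhB _ hθ34)
            (by positivity))
    _ = ρ * B * (y - x) + C₂ * B * y ^ θ := by ring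

end MoebiusRootCount

end Literature.NumberTheory.LFunctions
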